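import Literature.MathematicalPhysics.QuantumFieldTheory.Balaban1983to89.T4Crossover

/-!
# T⁴ programme, spine estimate NE9 — THE UV SLOT OF THE `n` UNPAIRED FINE SCALES IN KING's ORGANISATION IS PAID BY THE PRINTED SIZE BRANCH ALONE,
# UNIFORMLY IN `n` — census item C41 of cell `pub-balaban-gaps`, seat ne9 (gen 11)

Cell `pub-balaban-gaps` (YM blitz G2, seat ne9, unit `pub-balaban-gaps-ne9-g11`; record `run/shared/lean/pub/pub-balaban-gaps/ne/NE9.md` §5 row C41).
Summits-side bookkeeping over the tree's node-U4′ vocabulary (`T4Crossover.min_le_of_inv_sq_le`, `Step.Discrete031`).  NO definition; nothing of Bałaban's asserted.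

WHY.  King's template ([King1986] §3.2 p. 656: the lattices `T_{ε_K}` and `T_{ε_{K+n}}`; the finer run has `n` «unpaired» fine scales) needs the per-pair producers
of node U5 UNIFORMLY IN THE GAP `n` — the [v1.21] residue of this seat's census («the n-uniform restatement of node U5's producers», C38d:
`T4MatchingClosure.ReindexedBudget`'s radius slots `recent_remainder ≤ vol·r K` ∕ `uv_radius ≤ RrRec + vol·u K` with `r`, `u` independent of `n`; gen 10's handoff
door «the n-uniform one-step sources lemma»).  The one place where the gap `n` enters the E∕R-kinds EXPLICITLY is the block of `n` UNPAIRED fine scales of run `K + n`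
(no partner in run `K`'s dictionary; for `n = 1` the single finest scale of run B).  For the size-booked kinds that block needs no estimate at all: the field-dependent
parts of run `K + n`'s terms created at its scales `j < n` have `K + n − j ≥ K + 1` remaining scales, so per unit final volume the PRINTED one-run sizes give
* §1 E-kind ([Balaban1988Convergent] Thm 2 (2.43): contraction `a = L^{−β}` per remaining scale): `Σ_{j<n} E₁a^{K+n−j} ≤ E₁a^{K+1}∕(1 − a)` (`uvTail_le`) —
  n-UNIFORM, `→ 0` (`uvTail_tendsto`) and even SUMMABLE over `K` (`uvTail_summable`);
* §2 R-kind ((2.44): `R₁ g_j^{κ₀}`, not contracted, under the LOWER half of (0.31) `Step.Discrete031` for the run with `K + n` steps):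
  `Σ_{j<n} R₁ (g^{(K+n)}_j)^{κ₀} ≤ Σ_{i ≥ K+1} R₁(b₀ i)^{−κ₀∕2}` (`uvTailR_le`, p-series tail for `κ₀ > 2`) — n-UNIFORM, `→ 0` (`uvTailR_tendsto`).
NO two-run rate, NO E-side clause, NO window: on this slot King's currency (and the consecutive one) owes nothing beyond print for these kinds.

VERDICT FOR THE ROW (census C41).  Together with C39 (the paired scales' radius via the crossover) and C40 (the recent deviation via the adapted window): the
E∕R-kind contributions to the per-pair budget's radius and deviation slots (`DirectPairingApexBudget.cauchy_of_reindexedBudget`'s `r, u, s`) are reached n-uniformly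
from «a scale profile `b_j → 0`» (paired scales) resp. from PRINT alone (the `n` unpaired scales, this file); what stays with the T4-DAG owner is NE-R1's two-run
half PROPER — the RESUMMED large-field structure (remnant families of R-KIND, `uv_const`'s deviation `s₂`; record `t4/T4-EST-U5E-b.md` §4 R1), the large fields of
the unpaired scales (the class shell of `T4MatchingAssembly` §3 ∕ NE7c) and run `K + n`'s weights (NE7b).  CLASSIFICATION OF NE9 UNCHANGED: WORK-bound (W1;
instance 0∕1).

HONEST FRAMING: bookkeeping for rung (B)+1 on ONE FIXED finite four-torus; elementary real analysis (geometric and p-series tails); (2.43)∕(2.44) are Bałaban's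
printed Theorem 2 of [III], displayed as the SHAPE of a size branch and NOT proved here; (0.31) enters as the hypothesis `Step.Discrete031` (cell flag COND-BetaPertH);
NE9 NOT PRINTED ∕ NOT PROVED; spine PROVED 0∕9 unchanged; NOT UV stability, NOT the continuum limit, NOT infinite volume, NOT a mass gap, NOT Clay.  HONEST
DEPENDENCY: continuum YM on T⁴ ⇐ BetaPertH ∧ nine spine estimates (0∕9 proved); BetaPertH ⇐ (D1) ∧ (D4) ∧ CAP+tail.

References (TYPES only): [Balaban1988Convergent] = T. Bałaban, Commun. Math. Phys. **119** (1988) 243–285, Thm 2 (2.43)–(2.44) p. 263; [Balaban1987RG1] =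
T. Bałaban, Commun. Math. Phys. **109** (1987) 249–301, (0.31) p. 259; [King1986] = C. King, Commun. Math. Phys. **102** (1986) 649–677, §3.2 p. 656.
-/

namespace Summit.QuantumFields.BalabanUV.T4Continuum.NE9.DirectPairingUVTail

open scoped BigOperators
open Finset Filter Topology
open Literature.MathematicalPhysics.QuantumFieldTheory.Balaban1983to89

/-! ## §1 The E-kind: geometric tail of the printed contraction -/

/-- **THE E-KIND UV TAIL**: `Σ_{j<n} E₁·a^{K+n−j} ≤ E₁·a^{K+1}∕(1 − a)` for `E₁ ≥ 0`, `0 ≤ a < 1`, all `K`, `n` — the field-dependent parts of the `n` unpaired fine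
scales of run `K + n`, booked per unit final volume by the printed contraction per remaining scale, uniformly in `n`. [cite: Balaban1988Convergent, Thm 2 (2.43) p.263]
[folklore] -/
theorem uvTail_le {E₁ a : ℝ} (hE₁ : 0 ≤ E₁) (ha0 : 0 ≤ a) (ha1 : a < 1) (K n : ℕ) :
    ∑ j ∈ range n, E₁ * a ^ (K + n - j) ≤ E₁ * a ^ (K + 1) / (1 - a) := by
  have hrefl : ∑ j ∈ range n, E₁ * a ^ (K + n - j) = ∑ i ∈ range n, E₁ * a ^ (K + 1 + i) := by
    rw [← sum_range_reflect (fun i => E₁ * a ^ (K + 1 + i)) n]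
    refine sum_congr rfl fun j hj => ?_
    rw [mem_range] at hj
    congr 2
    omega
  rw [hrefl]
  have hgeom : ∑ i ∈ range n, a ^ i ≤ (1 - a)⁻¹ :=
    sum_le_hasSum _ (fun i _ => pow_nonneg ha0 i) (hasSum_geometric_of_lt_one ha0 ha1)
  calc ∑ i ∈ range n, E₁ * a ^ (K + 1 + i) = E₁ * a ^ (K + 1) * ∑ i ∈ range n, a ^ i := by
        rw [mul_sum]; exact sum_congr rfl fun i _ => by rw [pow_add]; ring
    _ ≤ E₁ * a ^ (K + 1) * (1 - a)⁻¹ := mul_le_mul_of_nonneg_left hgeom (mul_nonneg hE₁ (pow_nonneg ha0 _))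
    _ = E₁ * a ^ (K + 1) / (1 - a) := by rw [div_eq_mul_inv]

/-- The E-kind UV majorant `E₁a^{K+1}∕(1 − a)` tends to zero … [folklore] -/
theorem uvTail_tendsto {E₁ a : ℝ} (ha0 : 0 ≤ a) (ha1 : a < 1) :
    Tendsto (fun K : ℕ => E₁ * a ^ (K + 1) / (1 - a)) atTop (𝓝 0) := by
  have h := ((tendsto_pow_atTop_nhds_zero_of_lt_one ha0 ha1).comp (tendsto_add_atTop_nat 1)).const_mul E₁
  simpa [div_eq_mul_inv, mul_comm, mul_left_comm, mul_assoc] using h.mul_const ((1 - a)⁻¹)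

/-- … and is even summable over `K` (the consecutive currency's `Summable u` for this part, for free). [folklore] -/
theorem uvTail_summable {E₁ a : ℝ} (ha0 : 0 ≤ a) (ha1 : a < 1) :
    Summable (fun K : ℕ => E₁ * a ^ (K + 1) / (1 - a)) := by
  have h := ((summable_geometric_of_lt_one ha0 ha1).mul_left (E₁ * a / (1 - a)))
  refine h.congr fun K => ?_
  rw [pow_succ]; ring

/-! ## §2 The R-kind: p-series tail under the lower half of (0.31) -/

/-- **THE R-KIND UV TAIL**: under the LOWER half of (0.31) for the run with `K + n` steps (`Step.Discrete031 b₀ β′ (K+n) …`, `b₀ > 0`), nonnegative couplings,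
`R₁ ≥ 0` and `κ₀ > 2`, the R-sizes of the `n` finest scales satisfy `Σ_{j<n} R₁ (gs (K+n) j)^{κ₀} ≤ Σ_{i ≥ K+1} R₁(b₀ i)^{−κ₀∕2}` (each has `≥ K + 1` remaining
scales; `T4Crossover.min_le_of_inv_sq_le` with `D = b₀(K+n−j)`; a p-series tail) — uniformly in `n`. [cite: Balaban1988Convergent, Thm 2 (2.44) p.263] [folklore] -/
theorem uvTailR_le {b₀ β' R₁ : ℝ} {κ₀ : ℕ} {g : ℕ → ℝ} {gs : ℕ → ℕ → ℝ} (hb₀ : 0 < b₀)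
    (h031 : ∀ K, Step.Discrete031 b₀ β' K (g K) (gs K)) (hpos : ∀ K k, k ≤ K → 0 ≤ gs K k) (hR₁ : 0 ≤ R₁)
    (hκ : 2 < κ₀) (K n : ℕ) :
    ∑ j ∈ range n, R₁ * gs (K + n) j ^ κ₀ ≤ ∑' i : ℕ, R₁ * (b₀ * (((i + (K + 1) : ℕ) : ℝ)))⁻¹ ^ ((κ₀ : ℝ) / 2) := by
  -- termwise: for j < n, remaining scales (K+n) - j = K + 1 + (n - 1 - j) ≥ K + 1
  set c : ℕ → ℝ := fun i => R₁ * (b₀ * ((i : ℕ) : ℝ))⁻¹ ^ ((κ₀ : ℝ) / 2) with hc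
  have hc0 : ∀ i, 0 ≤ c i := fun i => mul_nonneg hR₁ (Real.rpow_nonneg (inv_nonneg.mpr (by positivity)) _)
  have hcs : Summable c := by
    have hp : 1 < (κ₀ : ℝ) / 2 := by
      have h2 : (2 : ℝ) < κ₀ := by exact_mod_cast hκ
      linarith
    have hs := (Real.summable_nat_rpow_inv.mpr hp).mul_left (R₁ * b₀⁻¹ ^ ((κ₀ : ℝ) / 2))
    refine hs.congr fun i => ?_
    show R₁ * b₀⁻¹ ^ ((κ₀ : ℝ) / 2) * ((i : ℝ) ^ ((κ₀ : ℝ) / 2))⁻¹ = R₁ * (b₀ * (i : ℝ))⁻¹ ^ ((κ₀ : ℝ) / 2)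
    rw [mul_inv, Real.mul_rpow (inv_nonneg.mpr hb₀.le) (inv_nonneg.mpr (Nat.cast_nonneg i)),
      Real.inv_rpow (Nat.cast_nonneg i)]
    ring
  have hterm : ∀ j ∈ range n, R₁ * gs (K + n) j ^ κ₀ ≤ c (K + n - j) := by
    intro j hj
    rw [mem_range] at hj
    have hjK : j ≤ K + n := by omega
    have hD : 0 < b₀ * (((K + n - j : ℕ) : ℝ)) := mul_pos hb₀ (by exact_mod_cast (show 0 < K + n - j by omega))
    have hle : b₀ * (((K + n - j : ℕ) : ℝ)) ≤ 1 / gs (K + n) j ^ 2 := by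
      have h1 := (h031 (K + n) j hjK).1
      have hKj : ((K + n : ℕ) : ℝ) - j = ((K + n - j : ℕ) : ℝ) := by
        rw [Nat.cast_sub hjK]
      rw [hKj] at h1
      have h2 : 0 ≤ 1 / g (K + n) ^ 2 := div_nonneg zero_le_one (sq_nonneg _)
      linarith
    have h := T4Crossover.min_le_of_inv_sq_le (κ₀ := κ₀) hR₁ (hpos (K + n) j hjK) hD hle (R₁ * gs (K + n) j ^ κ₀)
    rw [min_self] at h
    exact h
  -- reindex: j ↦ K + n - j maps range n injectively into [K+1, K+n]; bound by the tail tsum over i ≥ K + 1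
  calc ∑ j ∈ range n, R₁ * gs (K + n) j ^ κ₀ ≤ ∑ j ∈ range n, c (K + n - j) := sum_le_sum hterm
    _ = ∑ i ∈ range n, c (i + (K + 1)) := by
        rw [← sum_range_reflect (fun i => c (i + (K + 1))) n]
        refine sum_congr rfl fun j hj => ?_
        rw [mem_range] at hj
        congr 1
        omega
    _ ≤ ∑' i : ℕ, c (i + (K + 1)) :=
        ((summable_nat_add_iff (K + 1)).mpr hcs).sum_le_tsum (range n) (fun i _ => hc0 _)

/-- The R-kind UV majorant is the tail of a series, hence tends to zero in `K` (uniformly in `n` by `uvTailR_le`). [folklore] -/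
theorem uvTailR_tendsto {b₀ R₁ : ℝ} {κ₀ : ℕ} :
    Tendsto (fun K : ℕ => ∑' i : ℕ, R₁ * (b₀ * (((i + (K + 1) : ℕ) : ℝ)))⁻¹ ^ ((κ₀ : ℝ) / 2)) atTop (𝓝 0) := by
  set c : ℕ → ℝ := fun i => R₁ * (b₀ * ((i : ℕ) : ℝ))⁻¹ ^ ((κ₀ : ℝ) / 2) with hc
  have h := (tendsto_sum_nat_add c).comp (tendsto_add_atTop_nat 1)
  exact h

end Summit.QuantumFields.BalabanUV.T4Continuum.NE9.DirectPairingUVTail
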